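import Summits.BirchSwinnertonDyer.Rank1Residual.X5.SelmerSolitaireQuadraticNormalFormLemmas
import Mathlib.LinearAlgebra.BilinearForm.Orthogonal
import HarnessLib

/-!
# Selmer solitaire, QUADRATIC-SPACE LAYER (ii‴) — Q4a: the polar form of `Q_D` (support for the MOVE)

Cell `b2b-bsdres`, O1 programme (p = 2), ORDER v2.9 pool slot (ii‴) (o1 lead GEN 20, R-G20.3/R-G20.4,
PLAN C150/C153), support file for Q4 `…QuadraticMove.lean` (QS2a/QS2b); pool hand x11b3-p4 GEN 5.
Imports Q1 via p2's `X5.SelmerSolitaireQuadraticNormalFormLemmas` (`NF.qform_add`,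
`NF.polar_eq_zero_of_mem` reused BY NAME) + Mathlib's bilinear-form orthogonals.

HONEST FRAMING (cell, verbatim): research route; pure `𝔽₂` linear algebra — no curve, no Galois group,
no prime; nothing arithmetic asserted (the dictionary AR1–AR4 is NOT here); reach-neutral (R1 closes
no class); nothing booked; no mark / label / count moved; O1 OPEN. THEOREMS ONLY (no definition, no
named fact, no `sorry`).

## What is proved
§1 `q` and its polar form: `q(c x) = c q(x)`, alternation `⟨x,x⟩ = 0`, symmetry and bilinearity
(`polar_*`) — polarization `NF.qform_add` and `NF.polar_eq_zero_of_mem` (totally singular ⇒ totally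
isotropic) are IMPORTED from p2's `X5.SelmerSolitaireQuadraticNormalFormLemmas` (tree dedup). §2 The polar form is a NONDEGENERATE alternating form on
the `2(|D|+1)`-dimensional `Q_D` (`finrank_qvec`, `polar_single_fst/snd`): totally isotropic (a fortiori
totally singular) subspaces have dimension `≤ |D| + 1` (`finrank_le_of_isotropic`,
`finrank_le_of_qform_eq_zero` — so `IsTSLagrangian` = MAXIMAL totally singular), a totally singular
Lagrangian is its own orthogonal (`mem_of_forall_polar_eq_zero`), and every linear functional `ψ` is
`⟨η_ψ, ·⟩` for the EXPLICIT dual vector `η_ψ(v) = (ψ(t_v), ψ(u_v))` (`polar_dualVec`). §3 Coordinates on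
`Q_{D ∪ q} = Q_D ⊕ H_q`: `ι` (`iota_apply_oldV/new`, `iota_add/smul/zero`), `u_q` (`uNew_eq_single`,
`smul_uNew`), sums over the vertices (`sum_V_succ`), the decomposition `y = ι(old part) + (new
coordinates)_q` (`eq_iota_add_single`) and the forms in coordinates: `q(ι x + (a,b)_q) = q(x) + ab`
(`qform_iota_add_single`, `qform_iota`), `⟨ι x + (a,b)_q, ι x' + (a',b')_q⟩ = ⟨x,x'⟩ + ab' + ba'`
(`polar_iota_add_single`).

## References
* lens-2 GEN 5 G5.1 (Props A/B/C), GEN 10 2G10.2/2G10.6 (`cells/o1/ROUTES-O1.md` l.1966–1988);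
  B. Poonen, E. Rains, *Random maximal isotropic subspaces and Selmer groups*, JAMS 25 (2012), §2, §4
  (Prop. 4.10) [PoonenRains2012].
* Mathlib: `LinearMap.mk₂`, `LinearMap.BilinForm.Nondegenerate`, `LinearMap.BilinForm.finrank_orthogonal`,
  `Module.finrank_pi_fintype`, `Finset.univ_sum_single`. Tree dedup: `lean search 'polar_dualVec|finrank_qvec|mem_of_forall_polar'` → none; `qform_add` /
  `polar_eq_zero_of_mem` exist in p2's `NF` file ⇒ imported, not restated.
-/

namespace Summit.BirchSwinnertonDyer.Rank1Residual.X5.SelmerSolitaire.Quadratic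

open Finset Matrix SelmerSolitaire

variable {s : ℕ}

/-! ### §1 `q` and its polar form: polarization, alternation, linearity -/

/-- `q(c • x) = c · q(x)` over `𝔽₂` (`c² = c`). [folklore] -/
theorem qform_smul (c : ZMod 2) (x : QVec s) : qform (c • x) = c * qform x := by
  simp only [qform, Pi.smul_apply, Prod.smul_fst, Prod.smul_snd, smul_eq_mul, mul_sum]
  refine sum_congr rfl fun v _ => ?_
  rcases (by decide : ∀ c : ZMod 2, c = 0 ∨ c = 1) c with rfl | rfl <;> simp

/-- The polar form is ALTERNATING: `⟨x, x⟩ = 2 q(x) = 0`. [folklore] -/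
theorem polar_self (x : QVec s) : polar x x = 0 :=
  sum_eq_zero fun v _ => by rw [mul_comm (x v).2]; exact CharTwo.add_self_eq_zero _

/-- The polar form is symmetric. [folklore] -/
theorem polar_comm (x y : QVec s) : polar x y = polar y x :=
  sum_congr rfl fun v _ => by ring

/-- Additivity of the polar form in the first slot. [folklore] -/
theorem polar_add_left (x x' y : QVec s) : polar (x + x') y = polar x y + polar x' y := by
  simp only [polar, Pi.add_apply, Prod.fst_add, Prod.snd_add, ← sum_add_distrib]
  exact sum_congr rfl fun v _ => by ring

/-- Homogeneity of the polar form in the first slot. [folklore] -/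
theorem polar_smul_left (c : ZMod 2) (x y : QVec s) : polar (c • x) y = c * polar x y := by
  simp only [polar, Pi.smul_apply, Prod.smul_fst, Prod.smul_snd, smul_eq_mul, mul_sum]
  exact sum_congr rfl fun v _ => by ring

/-- Additivity in the second slot. [folklore] -/
theorem polar_add_right (x y y' : QVec s) : polar x (y + y') = polar x y + polar x y' := by
  rw [polar_comm, polar_add_left, polar_comm y, polar_comm y']

/-- Homogeneity in the second slot. [folklore] -/
theorem polar_smul_right (c : ZMod 2) (x y : QVec s) : polar x (c • y) = c * polar x y := by
  rw [polar_comm, polar_smul_left, polar_comm]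

/-- `⟨0, y⟩ = 0`. [folklore] -/
@[simp] theorem polar_zero_left (y : QVec s) : polar 0 y = 0 := by simp [polar]

/-- `⟨x, 0⟩ = 0`. [folklore] -/
@[simp] theorem polar_zero_right (x : QVec s) : polar x 0 = 0 := by simp [polar]

/-- `q(0) = 0`. [folklore] -/
@[simp] theorem qform_zero : qform (0 : QVec s) = 0 := by simp [qform]

/-! ### §2 The polar form as a nondegenerate bilinear form; dimension of totally isotropic subspaces -/

/-- Pairing with the basis vector `t_v = e_{v,2}` reads the `u`-coordinate. [folklore] -/
theorem polar_single_snd (x : QVec s) (v : V s) :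
    polar x (Pi.single v ((0, 1) : ZMod 2 × ZMod 2)) = (x v).1 := by
  simp only [polar]
  rw [sum_eq_single v (fun w _ hw => by simp [Pi.single_eq_of_ne hw]) (by simp)]
  simp

/-- Pairing with the basis vector `u_v = e_{v,1}` reads the `t`-coordinate. [folklore] -/
theorem polar_single_fst (x : QVec s) (v : V s) :
    polar x (Pi.single v ((1, 0) : ZMod 2 × ZMod 2)) = (x v).2 := by
  simp only [polar]
  rw [sum_eq_single v (fun w _ hw => by simp [Pi.single_eq_of_ne hw]) (by simp)]
  simp

/-- **Nondegeneracy of the polar form**: a vector pairing to `0` with everything is `0` (test against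
`t_v`, `u_v`). [cite: PoonenRains2012, §2] -/
theorem eq_zero_of_forall_polar_eq_zero {x : QVec s} (h : ∀ y, polar x y = 0) : x = 0 := by
  funext v
  apply Prod.ext
  · simpa [polar_single_snd] using h (Pi.single v (0, 1))
  · simpa [polar_single_fst] using h (Pi.single v (1, 0))

/-- `dim Q_D = 2 (|D| + 1)`. [folklore] -/
theorem finrank_qvec (s : ℕ) : Module.finrank (ZMod 2) (QVec s) = 2 * (s + 1) := by
  rw [Module.finrank_pi_fintype]
  simp [Module.finrank_prod, mul_comm]

/-- **Totally isotropic subspaces of `Q_D` have dimension `≤ |D| + 1`**: the polar form is a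
nondegenerate alternating form on the `2(|D|+1)`-dimensional space `Q_D`. [cite: PoonenRains2012, §2 (maximal isotropic subspaces)] -/
theorem finrank_le_of_isotropic (W : Submodule (ZMod 2) (QVec s))
    (hW : ∀ x ∈ W, ∀ y ∈ W, polar x y = 0) : Module.finrank (ZMod 2) W ≤ s + 1 := by
  -- the polar form as a bilinear form
  let B : LinearMap.BilinForm (ZMod 2) (QVec s) :=
    LinearMap.mk₂ (ZMod 2) polar polar_add_left polar_smul_left polar_add_right polar_smul_right
  have hB : B.Nondegenerate := by
    refine ⟨fun x hx => ?_, fun x hx => ?_⟩ <;> funext v <;> apply Prod.ext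
    · simpa [B, polar_single_snd] using hx (Pi.single v (0, 1))
    · simpa [B, polar_single_fst] using hx (Pi.single v (1, 0))
    · have := hx (Pi.single v (0, 1)); rw [LinearMap.mk₂_apply, polar_comm] at this
      simpa [polar_single_snd] using this
    · have := hx (Pi.single v (1, 0)); rw [LinearMap.mk₂_apply, polar_comm] at this
      simpa [polar_single_fst] using this
  have hle : W ≤ B.orthogonal W := fun x hx =>
    (LinearMap.BilinForm.mem_orthogonal_iff).mpr fun y hy => hW y hy x hx
  have h1 := Submodule.finrank_mono hle
  have h2 := LinearMap.BilinForm.finrank_orthogonal hB W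
  have h3 := Submodule.finrank_le W
  rw [finrank_qvec] at h2 h3
  omega

/-- Totally `q`-singular subspaces of `Q_D` have dimension `≤ |D| + 1` (so the Lagrangians of
`IsTSLagrangian` are the MAXIMAL ones). [cite: PoonenRains2012, §2] -/
theorem finrank_le_of_qform_eq_zero (W : Submodule (ZMod 2) (QVec s)) (hW : ∀ x ∈ W, qform x = 0) :
    Module.finrank (ZMod 2) W ≤ s + 1 :=
  finrank_le_of_isotropic W fun _ hx _ hy => NF.polar_eq_zero_of_mem hW hx hy

/-- **A totally singular Lagrangian is its own orthogonal**: if `⟨x, y⟩ = 0` for all `y ∈ U` then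
`x ∈ U` (else `U + ⟨x⟩` would be isotropic of dimension `|D| + 2`). [cite: PoonenRains2012, §2] -/
theorem mem_of_forall_polar_eq_zero {U : Submodule (ZMod 2) (QVec s)} (hU : IsTSLagrangian U)
    {x : QVec s} (hx : ∀ y ∈ U, polar x y = 0) : x ∈ U := by
  by_contra hxU
  have hiso : ∀ a ∈ U ⊔ (ZMod 2 ∙ x), ∀ c ∈ U ⊔ (ZMod 2 ∙ x), polar a c = 0 := by
    intro a ha c hc
    obtain ⟨u, hu, w, hw, rfl⟩ := Submodule.mem_sup.mp ha
    obtain ⟨u', hu', w', hw', rfl⟩ := Submodule.mem_sup.mp hc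
    obtain ⟨k, rfl⟩ := Submodule.mem_span_singleton.mp hw
    obtain ⟨k', rfl⟩ := Submodule.mem_span_singleton.mp hw'
    rw [polar_add_left, polar_add_right, polar_add_right, polar_smul_right, polar_smul_left,
      polar_smul_left, polar_smul_right, NF.polar_eq_zero_of_mem hU.1 hu hu', polar_comm u x,
      hx u' hu', hx u hu, polar_self]
    ring
  have hle := finrank_le_of_isotropic _ hiso
  have hlt : Module.finrank (ZMod 2) U < Module.finrank (ZMod 2) ↥(U ⊔ (ZMod 2 ∙ x)) :=
    Submodule.finrank_lt_finrank_of_lt (lt_of_le_of_ne le_sup_left fun h => hxU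
      (h ▸ Submodule.mem_sup_right (Submodule.mem_span_singleton_self x)))
  rw [hU.2] at hlt
  omega

/-- **The explicit dual vector**: for a linear functional `ψ` on `Q_D`, the vector
`η_ψ(v) = (ψ(t_v), ψ(u_v))` satisfies `⟨η_ψ, y⟩ = ψ(y)` for all `y`. [folklore] -/
theorem polar_dualVec (ψ : QVec s →ₗ[ZMod 2] ZMod 2) (y : QVec s) :
    polar (fun v => (ψ (Pi.single v (0, 1)), ψ (Pi.single v (1, 0)))) y = ψ y := by
  have hy : y = ∑ v, ((y v).1 • (Pi.single v ((1, 0) : ZMod 2 × ZMod 2) : QVec s) +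
      (y v).2 • (Pi.single v ((0, 1) : ZMod 2 × ZMod 2) : QVec s)) := by
    conv_lhs => rw [← Finset.univ_sum_single y]
    refine sum_congr rfl fun v _ => ?_
    rw [← Pi.single_smul, ← Pi.single_smul, ← Pi.single_add]
    congr 1
    ext <;> simp
  conv_rhs => rw [hy]
  simp only [map_sum, map_add, map_smul, smul_eq_mul, polar]
  exact sum_congr rfl fun v _ => by ring

/-! ### §3 Coordinates on `Q_{D ∪ q} = Q_D ⊕ H_q`: `ι`, the new vertex, `q` and the polar form -/

/-- `ι x` at an old vertex. [folklore] -/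
@[simp] theorem iota_apply_oldV (x : QVec s) (v : V s) : iota x (oldV v) = x v := by
  cases v with
  | none => rfl
  | some i => simp [iota, oldV]

/-- `ι x` vanishes at the new vertex `q`. [folklore] -/
@[simp] theorem iota_apply_new (x : QVec s) : iota x (some (Fin.last s)) = 0 := by
  simp [iota]

/-- A vector concentrated at the new vertex vanishes at the old vertices. [folklore] -/
@[simp] theorem single_new_apply_oldV (p : ZMod 2 × ZMod 2) (v : V s) :
    (Pi.single (some (Fin.last s)) p : QVec (s + 1)) (oldV v) = 0 := by
  rw [Pi.single_eq_of_ne (oldV_ne_new v)]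

/-- `ι` is additive. [folklore] -/
theorem iota_add (x y : QVec s) : iota (x + y) = iota x + iota y := by
  funext w; rcases w with _ | j
  · rfl
  · induction j using Fin.lastCases with
    | last => simp [iota]
    | cast i => simp [iota]

/-- `ι 0 = 0`. [folklore] -/
@[simp] theorem iota_zero : iota (0 : QVec s) = 0 := by
  funext w; rcases w with _ | j
  · rfl
  · induction j using Fin.lastCases with
    | last => simp [iota]
    | cast i => simp [iota]

/-- `ι` is homogeneous. [folklore] -/
theorem iota_smul (c : ZMod 2) (x : QVec s) : iota (c • x) = c • iota x := by
  funext w; rcases w with _ | j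
  · rfl
  · induction j using Fin.lastCases with
    | last => simp [iota]
    | cast i => simp [iota]

/-- `u_q` is the vector `(1, 0)` at the new vertex. [folklore] -/
theorem uNew_eq_single : uNew s = Pi.single (some (Fin.last s)) ((1, 0) : ZMod 2 × ZMod 2) := rfl

/-- `c • u_q = (c, 0)` at the new vertex. [folklore] -/
theorem smul_uNew (c : ZMod 2) : c • uNew s = Pi.single (some (Fin.last s)) ((c, 0) : ZMod 2 × ZMod 2) := by
  rw [uNew_eq_single, ← Pi.single_smul]
  congr 1; ext <;> simp

/-- Sums over the vertices of `D ∪ {q} ⊔ {∞}`: the new vertex plus the old ones. [folklore] -/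
theorem sum_V_succ {M : Type*} [AddCommMonoid M] (f : V (s + 1) → M) :
    ∑ w, f w = f (some (Fin.last s)) + ∑ v : V s, f (oldV v) := by
  rw [Fintype.sum_option, Fintype.sum_option, Fin.sum_univ_castSucc]
  simp only [oldV, Option.map_none, Option.map_some]
  abel

/-- **Every vector of `Q_{D ∪ q}` is `ι(old part) + (new coordinates)`.** [folklore] -/
theorem eq_iota_add_single (y : QVec (s + 1)) :
    y = iota (fun v => y (oldV v)) + Pi.single (some (Fin.last s)) (y (some (Fin.last s))) := by
  have key : ∀ v : V s, y (oldV v) =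
      (iota (fun v => y (oldV v)) + Pi.single (some (Fin.last s)) (y (some (Fin.last s))) :
        QVec (s + 1)) (oldV v) := fun v => by
    rw [Pi.add_apply, iota_apply_oldV, single_new_apply_oldV, add_zero]
  funext w; rcases w with _ | j
  · exact key none
  · induction j using Fin.lastCases with
    | last => simp
    | cast i => exact key (some i)

/-- **`q` on `Q_{D ∪ q}` in coordinates**: `q(ι x + (a, b)_q) = q(x) + a b`. [cite: PoonenRains2012, §4 (Prop. 4.10)] -/
theorem qform_iota_add_single (x : QVec s) (p : ZMod 2 × ZMod 2) :
    qform (iota x + Pi.single (some (Fin.last s)) p) = qform x + p.1 * p.2 := by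
  unfold qform
  rw [sum_V_succ, add_comm]
  simp

/-- `q(ι x) = q(x)`. [folklore] -/
theorem qform_iota (x : QVec s) : qform (iota x) = qform x := by
  simpa using qform_iota_add_single x 0

/-- **The polar form on `Q_{D ∪ q}` in coordinates**: `⟨ι x + (a,b)_q, ι x' + (a',b')_q⟩ =
⟨x, x'⟩ + (a b' + b a')`. [folklore] -/
theorem polar_iota_add_single (x x' : QVec s) (p p' : ZMod 2 × ZMod 2) :
    polar (iota x + Pi.single (some (Fin.last s)) p) (iota x' + Pi.single (some (Fin.last s)) p') =
      polar x x' + (p.1 * p'.2 + p.2 * p'.1) := by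
  unfold polar
  rw [sum_V_succ, add_comm]
  simp

/-- An element of `K′_ψ` in coordinates: `ι x + ψ(x) u_q = ι x + (ψ x, 0)_q`. [folklore] -/
theorem iota_add_smul_uNew (x : QVec s) (c : ZMod 2) :
    iota x + c • uNew s = iota x + Pi.single (some (Fin.last s)) ((c, 0) : ZMod 2 × ZMod 2) := by
  rw [smul_uNew]

end Summit.BirchSwinnertonDyer.Rank1Residual.X5.SelmerSolitaire.Quadratic
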